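import Summits.BirchSwinnertonDyer.BirchSwinnertonDyer.Theorems.CyclotomicUntwistInertiaOverCyclotomicNine
import Literature.NumberTheory.EllipticCurves.TateModuleTwistNewformEulerFactorsProofs
import Literature.NumberTheory.EllipticCurves.AnalyticRankOverNumberFieldArtinProofs
import Mathlib.LinearAlgebra.Eigenspace.Triangularizable
import HarnessLib

/-!
# Print layer (T) of crux child C1, file 3b-i: frame bookkeeping and the plane linear algebra
# (an endomorphism with `T⁶ = 1`, `T² ≠ 1` has an eigenvalue `ζ` with `ζ² ≠ 1`)

Cell `pub/bsd-wall` (D-0145 line `route-BirchSwinnertonDyer-CyclotomicUntwist`), seat `bsd-line-cycu-p1`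
(K1/K2 LEAD lineage, gen 8). THEOREMS ONLY (no definition, no named fact, no `sorry`); helper toward the crux
child C1 = stmt-BirchSwinnertonDyer-27548 through the print layer (T) (files 1, 2, 3a: p646654, p647742,
p648344). BSD is not proved by this file; no crux and no child of the route is proved by it.

WHAT. `W/ℚ` on a principal-series row at `3`, `VQ : Γ_ℚ → GL₂(ℚ_ℓ)` a frame of `V_ℓ(W)` (`eV`, `heV` as in
`exists_framedGaloisRep_rationalTate`), `𝔓 ∣ 3`.
* §1 `coe_eq_one_of_forall_apply_eq`, `charpoly_coe_eq` — frame bookkeeping (`VQ g = 1` when `ρ(g) = 1`;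
  `charpoly (VQ g) = charpoly ρ(g)`).
* §2 `exists_hasEigenvalue_sq_ne_one` — linear algebra: an endomorphism `T` of a plane over an algebraically
  closed field of characteristic `0` with `T⁶ = 1`, `T² ≠ 1` has an eigenvalue `ζ` with `ζ² ≠ 1`
  (`eq_smul_one_of_sq_eq_zero`: `(T − c)² = 0`, `T⁶ = 1`, `c⁶ = 1 ⇒ T = c`, Taylor expansion of `X⁶ − 1` at `c`).
(§3, the untwist datum itself, is the sequel file `CyclotomicUntwistUntwistDatum`.)

References: [cite: CarayolASENS1986, Thm. (A)] · [cite: SerreTate1968, §1–§2] · [cite: Washington1997, Ch. 3].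
-/

set_option autoImplicit false
-- single-conjunct summit: `Summit.BirchSwinnertonDyer.BirchSwinnertonDyer.…` repeats the name by design
set_option linter.dupNamespace false

noncomputable section

open scoped NumberField
open Polynomial Module NumberField IsDedekindDomain Field
  Literature.NumberTheory.GaloisRepresentations Literature.NumberTheory.EllipticCurves
  Summit.BirchSwinnertonDyer.Rank1Residual.Additive
  Summit.BirchSwinnertonDyer.BirchSwinnertonDyer.Theorems.InertiaOverCyclotomicNine

namespace Summit.BirchSwinnertonDyer.BirchSwinnertonDyer.Theorems.UntwistFrame

/-! ### §1 Frame bookkeeping -/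

section Frame

variable {ℓ : ℕ} [Fact ℓ.Prime] (W : WeierstrassCurve ℚ)
  (VQ : FramedGaloisRep ℚ ℚ_[ℓ] 2) (eV : (Fin 2 → ℚ_[ℓ]) ≃ₗ[ℚ_[ℓ]] W.rationalTateModule ℓ)
  (heV : ∀ (σ : absoluteGaloisGroup ℚ) (x : Fin 2 → ℚ_[ℓ]),
    eV (FramedRep.toRepresentation VQ σ x) = W.rationalGaloisRepTate ℓ σ (eV x))

include heV in
/-- In a frame `VQ` of `V_ℓ(W)`: `toLin' (VQ g) = eV⁻¹ ∘ ρ(g) ∘ eV`. [cite: SerreAbelianLadic1968, Ch. I §1.1] -/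
theorem toLin'_coe_eq_conj (g : absoluteGaloisGroup ℚ) :
    Matrix.toLin' ((VQ g : GL (Fin 2) ℚ_[ℓ]) : Matrix (Fin 2) (Fin 2) ℚ_[ℓ]) =
      eV.symm.conj (W.rationalGaloisRepTate ℓ g) := by
  refine LinearMap.ext fun x => ?_
  rw [Matrix.toLin'_apply, LinearEquiv.conj_apply_apply, LinearEquiv.symm_symm,
    ← FramedRep.toRepresentation_apply_apply, ← heV, LinearEquiv.symm_apply_apply]

include heV in
/-- In a frame `VQ` of `V_ℓ(W)`: if `ρ(g)` is the identity then `VQ g = 1` as a matrix.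
[cite: SerreAbelianLadic1968, Ch. I §1.1] -/
theorem coe_eq_one_of_forall_apply_eq {g : absoluteGaloisGroup ℚ}
    (h : ∀ x, W.rationalGaloisRepTate ℓ g x = x) :
    ((VQ g : GL (Fin 2) ℚ_[ℓ]) : Matrix (Fin 2) (Fin 2) ℚ_[ℓ]) = 1 := by
  apply Matrix.toLin'.injective
  rw [toLin'_coe_eq_conj W VQ eV heV, Matrix.toLin'_one]
  have h1 : W.rationalGaloisRepTate ℓ g = LinearMap.id := LinearMap.ext h
  rw [h1, LinearEquiv.conj_id]

include heV in
/-- In a frame `VQ` of `V_ℓ(W)`: the characteristic polynomial of the matrix `VQ g` is that of `ρ(g)`.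
[cite: SerreAbelianLadic1968, Ch. I §2.3] -/
theorem charpoly_coe_eq [Module.Finite ℚ_[ℓ] (W.rationalTateModule ℓ)] (g : absoluteGaloisGroup ℚ) :
    ((VQ g : GL (Fin 2) ℚ_[ℓ]) : Matrix (Fin 2) (Fin 2) ℚ_[ℓ]).charpoly =
      (W.rationalGaloisRepTate ℓ g).charpoly := by
  rw [← Matrix.charpoly_toLin', toLin'_coe_eq_conj W VQ eV heV, LinearEquiv.charpoly_conj]

end Frame

/-! ### §2 Linear algebra: an eigenvalue `ζ` with `ζ² ≠ 1` -/

section LinearAlgebra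

variable {K V : Type*} [Field K] [AddCommGroup V] [Module K V]

/-- `(T − c)² = 0`, `T⁶ = 1` and `c⁶ = 1` force `T = c` (characteristic `0`): Taylor expansion
`X⁶ − 1 = Q·(X − c)² + 6c⁵(X − c) + (c⁶ − 1)`. [folklore] -/
theorem eq_smul_one_of_sq_eq_zero [CharZero K] (T : Module.End K V) (c : K) (hc : c ^ 6 = 1)
    (h1 : (T - c • 1) ^ 2 = 0) (h6 : T ^ 6 = 1) : T = c • 1 := by
  have hc0 : c ≠ 0 := by rintro rfl; norm_num at hc
  -- Taylor identity in `K[X]`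
  have htaylor : (X ^ 6 - 1 : K[X]) =
      (C (15 * c ^ 4) + C (20 * c ^ 3) * (X - C c) + C (15 * c ^ 2) * (X - C c) ^ 2 +
          C (6 * c) * (X - C c) ^ 3 + (X - C c) ^ 4) * (X - C c) ^ 2 +
        C (6 * c ^ 5) * (X - C c) + C (c ^ 6 - 1) := by
    simp only [map_mul, map_pow, map_sub, map_one, map_ofNat]
    ring
  have hT : aeval T (X - C c) = T - c • 1 := by
    rw [map_sub, aeval_X, aeval_C, Algebra.algebraMap_eq_smul_one]
  have h2 : aeval T ((X - C c) ^ 2) = 0 := by rw [map_pow, hT, h1]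
  have h0 : aeval T (X ^ 6 - 1 : K[X]) = 0 := by rw [map_sub, map_pow, aeval_X, h6, map_one, sub_self]
  rw [htaylor, map_add, map_add, map_mul, h2, mul_zero, zero_add, map_mul, aeval_C, hT, aeval_C, hc,
    sub_self, map_zero, add_zero, Algebra.algebraMap_eq_smul_one, smul_one_mul, smul_eq_zero] at h0
  -- `6 c⁵ · (T − c) = 0`
  rcases h0 with h0 | h0
  · exfalso
    exact (mul_ne_zero (by norm_num) (pow_ne_zero 5 hc0)) h0
  · exact sub_eq_zero.mp h0

/-- **An endomorphism `T` of a plane over an algebraically closed field of characteristic `0` with `T⁶ = 1`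
and `T² ≠ 1` has an eigenvalue `ζ` with `ζ² ≠ 1`** (and every eigenvalue satisfies `ζ⁶ = 1`). If both
eigenvalues squared to `1`, then either they are distinct, `{1, −1}`, and Cayley–Hamilton gives `T² = 1`, or
they coincide and `(T − c)² = 0`, `T⁶ = 1` give `T = c`, `T² = c² = 1`. [folklore] -/
theorem exists_hasEigenvalue_sq_ne_one [IsAlgClosed K] [CharZero K] [FiniteDimensional K V]
    (h2 : finrank K V = 2) (T : Module.End K V) (h6 : T ^ 6 = 1) (hT : T ^ 2 ≠ 1) :
    ∃ c : K, T.HasEigenvalue c ∧ c ^ 2 ≠ 1 := by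
  classical
  haveI : Nontrivial V := Module.nontrivial_of_finrank_pos (R := K) (by rw [h2]; norm_num)
  -- every eigenvalue is a sixth root of unity
  have hroot6 : ∀ c, T.HasEigenvalue c → c ^ 6 = 1 := by
    intro c hc
    obtain ⟨v, hv⟩ := hc.exists_hasEigenvector
    have hpow : ∀ n : ℕ, (T ^ n) v = c ^ n • v := by
      intro n
      induction n with
      | zero => simp
      | succ n ih => rw [pow_succ', pow_succ', Module.End.mul_apply, ih, map_smul, hv.apply_eq_smul,
          smul_smul, mul_comm]
    have h := hpow 6
    rw [h6, Module.End.one_apply] at h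
    have h' : (c ^ 6 - 1) • v = 0 := by rw [sub_smul, ← h, one_smul, sub_self]
    rcases smul_eq_zero.mp h' with h' | h'
    · exact sub_eq_zero.mp h'
    · exact absurd h' hv.2
  by_contra H
  push Not at H
  -- an eigenvalue `c₀`, and the factorisation of the characteristic polynomial
  obtain ⟨c₀, hc₀⟩ := Module.End.exists_eigenvalue T
  have hc₀sq : c₀ ^ 2 = 1 := H c₀ hc₀
  set p := T.charpoly with hp
  have hmonic : p.Monic := LinearMap.charpoly_monic T
  have hdeg : p.natDegree = 2 := by rw [hp, LinearMap.charpoly_natDegree, h2]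
  have hr₀ : p.IsRoot c₀ := (Module.End.hasEigenvalue_iff_isRoot_charpoly T c₀).mp hc₀
  -- `p = X² + bX + e`
  set b := p.coeff 1 with hb
  set e := p.coeff 0 with he
  have hpe : p = X ^ 2 + C b * X + C e := by
    refine Polynomial.ext fun n => ?_
    rcases Nat.lt_or_ge n 3 with hn | hn
    · interval_cases n
      · simp [he]
      · simp [hb]
      · have := hmonic.coeff_natDegree; rw [hdeg] at this
        simp [this]
    · have hz : p.coeff n = 0 := Polynomial.coeff_eq_zero_of_natDegree_lt (by omega)
      rw [hz]
      simp only [coeff_add, coeff_C_mul, coeff_X_pow, coeff_C, coeff_X]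
      have h3 : n ≠ 2 := by omega
      have h4 : n ≠ 0 := by omega
      have h5 : (1 : ℕ) ≠ n := by omega
      simp [h3, h4, h5]
  set c₁ := -b - c₀ with hc₁
  have hfac : p = (X - C c₀) * (X - C c₁) := by
    have hr : c₀ ^ 2 + b * c₀ + e = 0 := by
      have := hr₀; rw [Polynomial.IsRoot, hpe] at this; simpa using this
    have he' : e = -c₀ ^ 2 - b * c₀ := by linear_combination hr
    rw [hpe, he', hc₁]
    simp only [map_sub, map_neg, map_mul, map_pow]
    ring
  -- `c₁` is an eigenvalue too
  have hr₁ : p.IsRoot c₁ := by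
    rw [hfac, Polynomial.IsRoot, eval_mul, eval_sub, eval_sub, eval_X, eval_C, eval_C, sub_self, mul_zero]
  have hc₁ev : T.HasEigenvalue c₁ := (Module.End.hasEigenvalue_iff_isRoot_charpoly T c₁).mpr hr₁
  have hc₁sq : c₁ ^ 2 = 1 := H c₁ hc₁ev
  -- Cayley–Hamilton
  have hCH : aeval T p = 0 := LinearMap.aeval_self_charpoly T
  by_cases heq : c₀ = c₁
  · -- `(T − c₀)² = 0` ⟹ `T = c₀` ⟹ `T² = 1`
    have h1 : (T - c₀ • 1) ^ 2 = 0 := by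
      rw [hfac, ← heq, ← sq, map_pow, map_sub, aeval_X, aeval_C, Algebra.algebraMap_eq_smul_one] at hCH
      exact hCH
    have hTc := eq_smul_one_of_sq_eq_zero T c₀ (hroot6 c₀ hc₀) h1 h6
    apply hT
    rw [hTc, _root_.smul_pow, one_pow, hc₀sq, one_smul]
  · -- distinct eigenvalues `±1`: `p = X² − 1`
    have hsum : c₀ + c₁ = 0 := by
      have hprod : (c₀ - c₁) * (c₀ + c₁) = 0 := by linear_combination hc₀sq - hc₁sq
      rcases mul_eq_zero.mp hprod with h | h
      · exact absurd (sub_eq_zero.mp h) heq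
      · exact h
    have hprod : c₀ * c₁ = -1 := by
      have : c₁ = -c₀ := by linear_combination hsum
      rw [this]; linear_combination -hc₀sq
    have hp1 : p = X ^ 2 - 1 := by
      rw [hfac]
      have : (X - C c₀) * (X - C c₁) = X ^ 2 - C (c₀ + c₁) * X + C (c₀ * c₁) := by
        simp only [map_add, map_mul]; ring
      rw [this, hsum, hprod]; simp [sub_eq_add_neg]
    apply hT
    rw [hp1, map_sub, map_pow, aeval_X, map_one] at hCH
    exact sub_eq_zero.mp hCH

end LinearAlgebra

end Summit.BirchSwinnertonDyer.BirchSwinnertonDyer.Theorems.UntwistFrame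

end
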